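import Mathlib

/-!
# Imbrie (2016), Assumption LLA — the interacting two-spin block: exact level crossings occur only for decoupled spins

CITATION HEADER (lean-in-tree rule 2026-08-18). J. Z. Imbrie, *On many-body localization for quantum spin chains*,
J. Stat. Phys. **163** (2016) 998–1048, doi 10.1007/s10955-016-1508-x, arXiv:1403.7837 [ImbrieJSP2016], eq. (1.1) (the chain
`H = Σ h_i S^z_i + Σ γ_i S^x_i + Σ J_i S^z_i S^z_{i+1}`), eq. (1.3) (Assumption LLA(ν, C)) and §4.2.1 (resonant blocks).

WHAT IS PROVED (a lemma of the audit cell `pub-imbrie`, seat LLA gen 6, `LLA.md` gen-6 block N6 / GAP (11)(e), statement (C1);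
NOT a statement of the paper).  For the two-spin block `H = h₁Z₁ + h₂Z₂ + J Z₁Z₂ + t₁X₁ + t₂X₂`, i.e. the real symmetric matrix
`M = !![h₁+h₂+J, t₂, t₁, 0; t₂, h₁-h₂-J, 0, t₁; t₁, 0, -h₁+h₂-J, t₂; 0, t₁, t₂, -h₁-h₂+J]` (basis ↑↑, ↑↓, ↓↑, ↓↓):
if both transverse fields are non-zero (`t₁ ≠ 0`, `t₂ ≠ 0`) and some eigenvalue `E₀` is DEGENERATE — witnessed, as it always can be for an
eigenspace of dimension ≥ 2, by an eigenvector vanishing at ↑↑ and an eigenvector vanishing at ↑↓ (`twoSpin_eigvec_vanishing_coord`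
extracts them from any two linearly independent eigenvectors) — then `J = 0`, `E₀ = 0` and `h₁² + t₁² = h₂² + t₂²`
(`twoSpin_degenerate_core` on the component equations, `twoSpin_double_eigenvalue` for `M.mulVec`).  That is: exact level
crossings of the interacting two-spin block happen only when the spins are DECOUPLED (`J = 0`) and have equal single-spin splittings
(`r₁ = r₂`), where the spectrum is `{−2r, 0, 0, 2r}`; with `J ≠ 0` every crossing is avoided.  This is the degeneracy-locus input (C1)
of the small-gap-volume analysis of the block (the "compact core" stratum of (V2-int)); it says NOTHING about whether LLA holds
for the chain (OPEN, pub-imbrie LLA.md).  No `sorry`, no new axioms, no definitions.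
-/

namespace Literature.MathematicalPhysics.QuantumLattice.Imbrie2016

/-- (C1), algebraic core: the eigen-equations of `M` for a vector `(0,b,c,d)` and for a vector `(a',0,c',d')` with the same
eigenvalue `E₀`, both non-zero, force `J = 0`, `E₀ = 0`, `h₁²+t₁² = h₂²+t₂²` (when `t₁ t₂ ≠ 0`). [cite: ImbrieJSP2016, eq. (1.1), §4.2.1] -/
theorem twoSpin_degenerate_core (h₁ h₂ J t₁ t₂ E₀ b c d a' c' d' : ℝ) (ht₁ : t₁ ≠ 0) (ht₂ : t₂ ≠ 0)
    (r0 : t₂ * b + t₁ * c = 0)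
    (r1 : (h₁ - h₂ - J - E₀) * b + t₁ * d = 0)
    (r2 : (-h₁ + h₂ - J - E₀) * c + t₂ * d = 0)
    (r3 : t₁ * b + t₂ * c + (-h₁ - h₂ + J - E₀) * d = 0)
    (hψ : ¬ (b = 0 ∧ c = 0 ∧ d = 0))
    (s0 : (h₁ + h₂ + J - E₀) * a' + t₁ * c' = 0)
    (s1 : t₂ * a' + t₁ * d' = 0)
    (s3 : t₂ * c' + (-h₁ - h₂ + J - E₀) * d' = 0)
    (hφ : ¬ (a' = 0 ∧ c' = 0 ∧ d' = 0)) :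
    J = 0 ∧ E₀ = 0 ∧ h₁ ^ 2 + t₁ ^ 2 = h₂ ^ 2 + t₂ ^ 2 := by
  -- ψ-side: b ≠ 0 and E₀ = -J
  have hb : b ≠ 0 := by
    intro hb
    apply hψ
    refine ⟨hb, ?_, ?_⟩
    · have : t₁ * c = 0 := by linear_combination r0 - t₂ * hb
      rcases mul_eq_zero.mp this with h | h
      · exact absurd h ht₁
      · exact h
    · have : t₁ * d = 0 := by linear_combination r1 - (h₁ - h₂ - J - E₀) * hb
      rcases mul_eq_zero.mp this with h | h
      · exact absurd h ht₁
      · exact h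
  have k1 : (t₂ * b) * ((h₁ - h₂ - J - E₀) + (-h₁ + h₂ - J - E₀)) = 0 := by
    linear_combination (-t₁) * r2 + (-h₁ + h₂ - J - E₀) * r0 + t₂ * r1
  have e1 : E₀ = -J := by
    have htb : t₂ * b ≠ 0 := mul_ne_zero ht₂ hb
    have := (mul_eq_zero.mp k1).resolve_left htb
    linarith
  -- φ-side: a' ≠ 0 and E₀ = J
  have ha : a' ≠ 0 := by
    intro ha
    apply hφ
    refine ⟨ha, ?_, ?_⟩
    · have : t₁ * c' = 0 := by linear_combination s0 - (h₁ + h₂ + J - E₀) * ha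
      rcases mul_eq_zero.mp this with h | h
      · exact absurd h ht₁
      · exact h
    · have : t₁ * d' = 0 := by linear_combination s1 - t₂ * ha
      rcases mul_eq_zero.mp this with h | h
      · exact absurd h ht₁
      · exact h
  have k2 : (t₂ * a') * ((h₁ + h₂ + J - E₀) + (-h₁ - h₂ + J - E₀)) = 0 := by
    linear_combination (-t₁) * s3 + t₂ * s0 + (-h₁ - h₂ + J - E₀) * s1
  have e2 : E₀ = J := by
    have hta : t₂ * a' ≠ 0 := mul_ne_zero ht₂ ha
    have := (mul_eq_zero.mp k2).resolve_left hta
    linarith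
  have hJ : J = 0 := by linarith
  have hE : E₀ = 0 := by linarith
  -- the remaining row of the ψ-equations gives r₁ = r₂
  have k3 : b * (t₁ ^ 2 - t₂ ^ 2 - (h₁ - h₂ - J - E₀) * (-h₁ - h₂ + J - E₀)) = 0 := by
    linear_combination t₁ * r3 - t₂ * r0 - (-h₁ - h₂ + J - E₀) * r1
  have k3' := (mul_eq_zero.mp k3).resolve_left hb
  refine ⟨hJ, hE, ?_⟩
  rw [hJ, hE] at k3'
  linear_combination k3'

/-- From any two linearly independent eigenvectors with the same eigenvalue one gets a non-zero eigenvector vanishing at a prescribed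
coordinate (elementary; stated for `Fin 4`). [cite: ImbrieJSP2016, eq. (1.1)] -/
theorem twoSpin_eigvec_vanishing_coord (M : Matrix (Fin 4) (Fin 4) ℝ) (E₀ : ℝ) (v w : Fin 4 → ℝ)
    (hv : M.mulVec v = E₀ • v) (hw : M.mulVec w = E₀ • w)
    (hind : ∀ α β : ℝ, α • v + β • w = 0 → α = 0 ∧ β = 0) (i : Fin 4) :
    ∃ ψ : Fin 4 → ℝ, M.mulVec ψ = E₀ • ψ ∧ ψ i = 0 ∧ ψ ≠ 0 := by
  by_cases hvi : v i = 0
  · refine ⟨v, hv, hvi, ?_⟩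
    intro hv0
    have := hind 1 0 (by simp [hv0])
    exact one_ne_zero this.1
  · refine ⟨w i • v + (-(v i)) • w, ?_, ?_, ?_⟩
    · rw [Matrix.mulVec_add, Matrix.mulVec_smul, Matrix.mulVec_smul, hv, hw, smul_add, smul_comm (w i) E₀ v,
        smul_comm (-(v i)) E₀ w]
    · simp [mul_comm]
    · intro h0
      have := hind (w i) (-(v i)) h0
      exact hvi (neg_eq_zero.mp this.2)

/-- (C1) for the matrix: if `t₁ t₂ ≠ 0` and the eigenvalue `E₀` of the two-spin block has two linearly independent eigenvectors,
then `J = 0`, `E₀ = 0` and `h₁²+t₁² = h₂²+t₂²` — exact crossings only for decoupled spins. [cite: ImbrieJSP2016, eq. (1.1), §4.2.1] -/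
theorem twoSpin_double_eigenvalue (h₁ h₂ J t₁ t₂ E₀ : ℝ) (ht₁ : t₁ ≠ 0) (ht₂ : t₂ ≠ 0) (v w : Fin 4 → ℝ)
    (hv : (!![h₁+h₂+J, t₂, t₁, 0; t₂, h₁-h₂-J, 0, t₁; t₁, 0, -h₁+h₂-J, t₂; 0, t₁, t₂, -h₁-h₂+J] :
      Matrix (Fin 4) (Fin 4) ℝ).mulVec v = E₀ • v)
    (hw : (!![h₁+h₂+J, t₂, t₁, 0; t₂, h₁-h₂-J, 0, t₁; t₁, 0, -h₁+h₂-J, t₂; 0, t₁, t₂, -h₁-h₂+J] :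
      Matrix (Fin 4) (Fin 4) ℝ).mulVec w = E₀ • w)
    (hind : ∀ α β : ℝ, α • v + β • w = 0 → α = 0 ∧ β = 0) :
    J = 0 ∧ E₀ = 0 ∧ h₁ ^ 2 + t₁ ^ 2 = h₂ ^ 2 + t₂ ^ 2 := by
  set M : Matrix (Fin 4) (Fin 4) ℝ :=
    !![h₁+h₂+J, t₂, t₁, 0; t₂, h₁-h₂-J, 0, t₁; t₁, 0, -h₁+h₂-J, t₂; 0, t₁, t₂, -h₁-h₂+J] with hM
  obtain ⟨ψ, hψ, hψ0, hψne⟩ := twoSpin_eigvec_vanishing_coord M E₀ v w hv hw hind 0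
  obtain ⟨φ, hφ, hφ1, hφne⟩ := twoSpin_eigvec_vanishing_coord M E₀ v w hv hw hind 1
  have p0 := congrFun hψ 0
  have p1 := congrFun hψ 1
  have p2 := congrFun hψ 2
  have p3 := congrFun hψ 3
  have q0 := congrFun hφ 0
  have q1 := congrFun hφ 1
  have q3 := congrFun hφ 3
  simp [hM, Matrix.mulVec, dotProduct, Fin.sum_univ_four, hψ0] at p0 p1 p2 p3
  simp [hM, Matrix.mulVec, dotProduct, Fin.sum_univ_four, hφ1] at q0 q1 q3
  refine twoSpin_degenerate_core h₁ h₂ J t₁ t₂ E₀ (ψ 1) (ψ 2) (ψ 3) (φ 0) (φ 2) (φ 3) ht₁ ht₂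
    ?_ ?_ ?_ ?_ ?_ ?_ ?_ ?_ ?_
  · linear_combination p0
  · linear_combination p1
  · linear_combination p2
  · linear_combination p3
  · rintro ⟨h1, h2, h3⟩
    apply hψne
    funext i
    fin_cases i <;> simp [hψ0, h1, h2, h3]
  · linear_combination q0
  · linear_combination q1
  · linear_combination q3
  · rintro ⟨h0, h2, h3⟩
    apply hφne
    funext i
    fin_cases i <;> simp [hφ1, h0, h2, h3]

end Literature.MathematicalPhysics.QuantumLattice.Imbrie2016
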